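import Literature.Computability.QuantumComplexity.DecisionTreeSimulation
import Literature.Computability.QuantumComplexity.AaronsonAmbainis
import HarnessLib

/-!
# The address function: `m + 2^m` relevant variables, exact quantum query complexity `≤ m + 1`

Topic `Computability/QuantumComplexity`. The tightness witness for the "Ω(log n)" floors on the degree /
exact quantum query complexity of total Boolean functions depending on `n` variables (Nisan–Szegedy 1994),
as printed in A. Ambainis, R. de Wolf, *How low can approximate degree and quantum query complexity be for
total Boolean functions?*, CCC 2013 [AmbainisWolf2012] (held text `paper:arxiv-1206.0717`, §1.1, p. 3 L55–60):

> As Nisan and Szegedy observe, this lower bound is tight up to the `O(log log n)` term for the address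
> function: let `k` be some power of 2, `n = k + log k`, and view the last `log k` bits of the `n`-bit input
> as an address in the first `k` bits. Define `f(x)` as the value of the addressed variable. This function
> depends on all `n` variables and has degree `log k + 1 ≤ log n + 1` […]

and in R. de Wolf, *A brief introduction to Fourier analysis on the Boolean cube*, ToC Graduate Surveys 1
(2008) [DeWolf2008] (held text `paper:doi-10-4086-toc-gs-2008-001`, p. 10 L25), whose layout we follow:

> This function takes an input `x_1 … x_m y_0 … y_{2^m−1}` of `n = m + 2^m` bits, and outputs `y_i` where `i`
> is the number whose binary representation is `x_1 … x_m`. The function depends on all `n` variables. It is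
> represented by […] and hence has degree `m + 1 ≤ log n + 1`.

What is typed, in the tree's vocabulary (`Complexity.DecisionTree`, `QQueryAlg`, `Q_E = quantumQueryComplexity 0`,
`flipBit i x = Function.update x i (!x i)` of `AaronsonAmbainis.lean`, the relevance convention of the
junta ceilings):

* `addrFn m : (Fin (m + 2^m) → Bool) → Bool` — the first `m` bits are the binary digits of the address
  (Mathlib's canonical `finFunctionFinEquiv : (Fin m → Fin 2) ≃ Fin (2^m)`, digit `j` weighted `2^j`), the
  last `2^m` bits the table; the value is the addressed table bit;
* **`addrFn_depends_on_all`** — every one of the `m + 2^m` variables is relevant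
  (`∀ i, ∃ x, addrFn m (flipBit i x) ≠ addrFn m x`);
* `tree m` — the obvious decision tree (read the `m` address bits, then the addressed table bit),
  `depth_tree : (tree m).depth = m + 1`, `computes_tree`; hence `detQueryComplexity_addrFn_le` (`D ≤ m + 1`) and
  **`quantumQueryComplexity_zero_addrFn_le : quantumQueryComplexity 0 (addrFn m) ≤ m + 1`** BY NAME through the
  tree's exact simulation of decision trees (`quantumQueryComplexity_zero_le_depth`, `Q_E ≤ D`);
* the display `two_pow_le_card_of_addrFn`: `2^(Q_E − 1) ≤ m + 2^m = n` — a total function with ALL `n` variables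
  relevant and `n ≥ 2^{Q_E(f) − 1}`, so a relevance ceiling of the shape `n ≤ g(Q_E)` valid for every total
  function must have `g(T) ≥ 2^{T−1}` (the exponential shape of the junta ceilings cannot be improved to a
  polynomial one).

The printed degree statement (`deg = m + 1`) and the `O(log log n)` comparison are not typed here. Everything is
proved; no fact, instance, notation or axiom is introduced.

## References

* [AmbainisWolf2012] A. Ambainis, R. de Wolf, *How low can approximate degree and quantum query complexity be
  for total Boolean functions?*, Proc. IEEE CCC 2013; comput. complexity 23 (2014); arXiv:1206.0717 — §1.1,
  p. 3 L55–60 (the address function, after Nisan–Szegedy).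
* [DeWolf2008] R. de Wolf, *A brief introduction to Fourier analysis on the Boolean cube*, Theory of Computing
  Graduate Surveys 1 (2008) 1–20 — §4.4, p. 10 (the address function on `m + 2^m` bits).
* [NisanSzegedy1994] N. Nisan, M. Szegedy, *On the degree of Boolean functions as real polynomials*, comput.
  complexity 4 (1994) 301–313 (the original observation; cited through the two held texts above).
* [Wolf2002] H. Buhrman, R. de Wolf, *Complexity measures and decision tree complexity: a survey*, Theoret.
  Comput. Sci. 288 (2002) — §3.3 (`Q_E(f) ≤ D(f)`, the tree's `quantumQueryComplexity_zero_le_depth`).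
-/

namespace Literature.Computability.QuantumComplexity.AddressFunction

open Finset Literature.Computability.Complexity Literature.Computability.Complexity.DecisionTree
  Literature.Computability.Cryptography

variable {m : ℕ}

/-- Address positions and table positions are distinct. [folklore] -/
private theorem castAdd_ne_natAdd (j : Fin m) (t : Fin (2 ^ m)) : Fin.castAdd (2 ^ m) j ≠ Fin.natAdd m t := by
  intro h
  have h' := congrArg Fin.val h
  simp only [Fin.val_castAdd, Fin.val_natAdd] at h'
  have := j.isLt
  omega

/-- The two elements of `Fin 2` as an `if`. [folklore] -/
private theorem fin_two_ite (i : Fin 2) : (if i = 1 then (1 : Fin 2) else 0) = i := by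
  revert i
  rw [Fin.forall_fin_two]
  decide

/-- The table used to witness the relevance of the address bits: `y_0 = 0`, `y_i = 1` for `i ≠ 0`. [folklore] -/
private def tableY (m : ℕ) : Fin (2 ^ m) → Bool := fun t => decide ((t : ℕ) ≠ 0)

/-! ### The address function -/

/-- The binary digits of the address: digit `j` is the `j`-th of the first `m` input bits. [cite: DeWolf2008, §4.4 p. 10] -/
def digits (x : Fin (m + 2 ^ m) → Bool) : Fin m → Fin 2 :=
  fun j => if x (Fin.castAdd (2 ^ m) j) = true then 1 else 0

/-- The address `i ∈ {0, …, 2^m − 1}` "whose binary representation is `x_1 … x_m`" (digit `j` weighted `2^j`,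
Mathlib `finFunctionFinEquiv`). [cite: DeWolf2008, §4.4 p. 10] -/
def addr (x : Fin (m + 2 ^ m) → Bool) : Fin (2 ^ m) :=
  finFunctionFinEquiv (digits x)

/-- **The address function** on `n = m + 2^m` bits: inputs `x_1 … x_m y_0 … y_{2^m−1}`, output the addressed
table bit `y_{addr x}`. [cite: DeWolf2008, §4.4 p. 10] -/
def addrFn (m : ℕ) (x : Fin (m + 2 ^ m) → Bool) : Bool :=
  x (Fin.natAdd m (addr x))

/-- Unfolding the address function. [cite: DeWolf2008, §4.4 p. 10] -/
theorem addrFn_apply (x : Fin (m + 2 ^ m) → Bool) : addrFn m x = x (Fin.natAdd m (addr x)) := rfl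

/-- The address depends on the address bits only. [cite: DeWolf2008, §4.4 p. 10] -/
theorem addr_congr {x y : Fin (m + 2 ^ m) → Bool} (h : ∀ j : Fin m, x (Fin.castAdd (2 ^ m) j) = y (Fin.castAdd (2 ^ m) j)) :
    addr x = addr y := by
  unfold addr digits
  congr 1
  funext j
  rw [h j]

/-- Flipping a table bit does not move the address. [cite: DeWolf2008, §4.4 p. 10] -/
theorem addr_flipBit_natAdd (x : Fin (m + 2 ^ m) → Bool) (t : Fin (2 ^ m)) :
    addr (flipBit (Fin.natAdd m t) x) = addr x :=
  addr_congr fun j => by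
    rw [flipBit, Function.update_of_ne (castAdd_ne_natAdd j t)]

/-! ### Every variable is relevant -/

/-- The input with address digits `a` and table `y`. [cite: DeWolf2008, §4.4 p. 10] -/
def mkInput (a : Fin m → Fin 2) (y : Fin (2 ^ m) → Bool) : Fin (m + 2 ^ m) → Bool :=
  Fin.append (fun j => decide (a j = 1)) y

/-- The address of `mkInput a y` is the number with digits `a`. [cite: DeWolf2008, §4.4 p. 10] -/
theorem addr_mkInput (a : Fin m → Fin 2) (y : Fin (2 ^ m) → Bool) : addr (mkInput a y) = finFunctionFinEquiv a := by
  unfold addr digits mkInput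
  congr 1
  funext j
  rw [Fin.append_left]
  simp only [decide_eq_true_eq]
  exact fin_two_ite (a j)

/-- The table bits of `mkInput a y` are `y`. [cite: DeWolf2008, §4.4 p. 10] -/
theorem mkInput_natAdd (a : Fin m → Fin 2) (y : Fin (2 ^ m) → Bool) (t : Fin (2 ^ m)) :
    mkInput a y (Fin.natAdd m t) = y t := by
  unfold mkInput
  rw [Fin.append_right]

/-- The address function reads the addressed table bit of `mkInput a y`. [cite: DeWolf2008, §4.4 p. 10] -/
theorem addrFn_mkInput (a : Fin m → Fin 2) (y : Fin (2 ^ m) → Bool) :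
    addrFn m (mkInput a y) = y (finFunctionFinEquiv a) := by
  rw [addrFn_apply, addr_mkInput, mkInput_natAdd]

/-- **Every table bit is relevant**: address it and flip it. [cite: DeWolf2008, §4.4 p. 10] -/
theorem addrFn_flipBit_natAdd_ne (t : Fin (2 ^ m)) :
    ∃ x, addrFn m (flipBit (Fin.natAdd m t) x) ≠ addrFn m x := by
  refine ⟨mkInput (finFunctionFinEquiv.symm t) (fun _ => false), ?_⟩
  rw [addrFn_apply, addr_flipBit_natAdd, addr_mkInput, Equiv.apply_symm_apply, addrFn_mkInput]
  simp [flipBit, mkInput_natAdd]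

/-- Flipping address bit `j` of the all-zero address gives the address `2^j`. [cite: DeWolf2008, §4.4 p. 10] -/
theorem addr_flipBit_castAdd_zero (y : Fin (2 ^ m) → Bool) (j : Fin m) :
    addr (flipBit (Fin.castAdd (2 ^ m) j) (mkInput (fun _ => 0) y)) = finFunctionFinEquiv (Pi.single j (1 : Fin 2)) := by
  rw [← addr_mkInput (Pi.single j 1) y]
  refine addr_congr fun j' => ?_
  unfold mkInput
  by_cases hj : j' = j
  · subst hj
    rw [flipBit, Function.update_self, Fin.append_left, Fin.append_left]
    simp
  · rw [flipBit, Function.update_of_ne (fun h => hj (Fin.castAdd_injective _ _ h)), Fin.append_left,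
      Fin.append_left]
    simp [hj]

/-- **Every address bit is relevant**: with the table `y_0 = 0`, `y_i = 1 (i ≠ 0)` and the all-zero address,
flipping address bit `j` moves the address from `0` to `2^j ≠ 0`. [cite: DeWolf2008, §4.4 p. 10] -/
theorem addrFn_flipBit_castAdd_ne (j : Fin m) :
    ∃ x, addrFn m (flipBit (Fin.castAdd (2 ^ m) j) x) ≠ addrFn m x := by
  refine ⟨mkInput (fun _ => 0) (tableY m), ?_⟩
  have h0 : addrFn m (mkInput (fun _ => (0 : Fin 2)) (tableY m)) = false := by
    rw [addrFn_mkInput]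
    have : ((finFunctionFinEquiv fun _ : Fin m => (0 : Fin 2)) : ℕ) = 0 := by
      rw [finFunctionFinEquiv_apply]; simp
    simp [tableY, this]
  have h1 : addrFn m (flipBit (Fin.castAdd (2 ^ m) j) (mkInput (fun _ => (0 : Fin 2)) (tableY m))) = true := by
    rw [addrFn_apply, addr_flipBit_castAdd_zero, flipBit, Function.update_of_ne (castAdd_ne_natAdd j _).symm,
      mkInput_natAdd]
    have : ((finFunctionFinEquiv (Pi.single j (1 : Fin 2))) : ℕ) ≠ 0 := by
      rw [finFunctionFinEquiv_single]; simp
    exact decide_eq_true this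
  rw [h0, h1]
  decide

/-- **The address function depends on all `m + 2^m` variables** ("The function depends on all `n`
variables"), in the relevance convention of the tree's junta ceilings (`f (flipBit i x) ≠ f x` for some `x`).
[cite: DeWolf2008, §4.4 p. 10] -/
theorem addrFn_depends_on_all (i : Fin (m + 2 ^ m)) : ∃ x, addrFn m (flipBit i x) ≠ addrFn m x := by
  induction i using Fin.addCases with
  | left j => exact addrFn_flipBit_castAdd_ne j
  | right t => exact addrFn_flipBit_natAdd_ne t

/-! ### The decision tree: read the address, then the addressed bit -/

/-- The address recorded so far, merged with the bits still to be read: positions `< m − k` from `acc`, the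
others from the input. [cite: DeWolf2008, §4.4 p. 10] -/
def merge (acc : Fin m → Bool) (x : Fin (m + 2 ^ m) → Bool) (k : ℕ) : Fin m → Bool :=
  fun j => if (j : ℕ) < m - k then acc j else x (Fin.castAdd (2 ^ m) j)

/-- The decision tree with `k` address bits still to read (positions `m − k, …, m − 1`), the earlier answers
recorded in `acc`; with no bit left it queries the addressed table bit and outputs it. [cite: DeWolf2008, §4.4 p. 10] -/
def treeAux (m : ℕ) : ℕ → (Fin m → Bool) → DecisionTree (m + 2 ^ m)
  | 0, acc => query (Fin.natAdd m (finFunctionFinEquiv fun j => if acc j = true then (1 : Fin 2) else 0))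
      (leaf false) (leaf true)
  | k + 1, acc =>
    if h : m - (k + 1) < m then
      query (Fin.castAdd (2 ^ m) ⟨m - (k + 1), h⟩)
        (treeAux m k (Function.update acc ⟨m - (k + 1), h⟩ false))
        (treeAux m k (Function.update acc ⟨m - (k + 1), h⟩ true))
    else leaf false

/-- **The decision tree of the address function**: read the `m` address bits in order, then the addressed
table bit. [cite: DeWolf2008, §4.4 p. 10] -/
def tree (m : ℕ) : DecisionTree (m + 2 ^ m) :=
  treeAux m m fun _ => false

/-- The auxiliary tree with `k ≤ m` bits to read has depth `k + 1`. [cite: DeWolf2008, §4.4 p. 10] -/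
theorem depth_treeAux {k : ℕ} (hk : k ≤ m) (acc : Fin m → Bool) : (treeAux m k acc).depth = k + 1 := by
  induction k generalizing acc with
  | zero => rfl
  | succ k ih =>
    have h : m - (k + 1) < m := by omega
    rw [treeAux, dif_pos h, depth, ih (by omega), ih (by omega), max_self]

/-- **`depth (tree m) = m + 1`.** [cite: DeWolf2008, §4.4 p. 10] -/
theorem depth_tree (m : ℕ) : (tree m).depth = m + 1 :=
  depth_treeAux le_rfl _

/-- Recording the answer at position `m − (k+1)` and merging from `m − k` on is merging from `m − (k+1)` on.
[cite: DeWolf2008, §4.4 p. 10] -/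
theorem merge_update {k : ℕ} (h : m - (k + 1) < m) (acc : Fin m → Bool) (x : Fin (m + 2 ^ m) → Bool) :
    merge (Function.update acc ⟨m - (k + 1), h⟩ (x (Fin.castAdd (2 ^ m) ⟨m - (k + 1), h⟩))) x k =
      merge acc x (k + 1) := by
  funext j
  unfold merge
  by_cases hj : j = ⟨m - (k + 1), h⟩
  · subst hj
    rw [Function.update_self]
    simp
  · rw [Function.update_of_ne hj]
    have hj' : (j : ℕ) ≠ m - (k + 1) := fun e => hj (Fin.ext e)
    by_cases h1 : (j : ℕ) < m - (k + 1)
    · rw [if_pos (by omega), if_pos h1]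
    · rw [if_neg (by omega), if_neg h1]

/-- The auxiliary tree outputs the table bit addressed by the merged address. [cite: DeWolf2008, §4.4 p. 10] -/
theorem eval_treeAux {k : ℕ} (hk : k ≤ m) (acc : Fin m → Bool) (x : Fin (m + 2 ^ m) → Bool) :
    (treeAux m k acc).eval x =
      x (Fin.natAdd m (finFunctionFinEquiv fun j => if merge acc x k j = true then (1 : Fin 2) else 0)) := by
  induction k generalizing acc with
  | zero =>
    have hm : merge acc x 0 = acc := by
      funext j; unfold merge; rw [if_pos (by have := j.isLt; omega)]
    rw [hm, treeAux, eval]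
    cases x (Fin.natAdd m (finFunctionFinEquiv fun j => if acc j = true then (1 : Fin 2) else 0)) <;> rfl
  | succ k ih =>
    have h : m - (k + 1) < m := by omega
    rw [treeAux, dif_pos h, eval, ih (by omega), ih (by omega), ← merge_update h acc x]
    cases x (Fin.castAdd (2 ^ m) ⟨m - (k + 1), h⟩) <;> simp

/-- **The tree computes the address function.** [cite: DeWolf2008, §4.4 p. 10] -/
theorem computes_tree (m : ℕ) : (tree m).Computes (addrFn m) := by
  intro x
  rw [tree, eval_treeAux le_rfl, addrFn_apply]
  have hm : merge (fun _ => false) x m = fun j => x (Fin.castAdd (2 ^ m) j) := by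
    funext j; unfold merge; rw [if_neg (by omega)]
  rw [hm]
  rfl

/-! ### Consequences: `D ≤ m + 1`, `Q_E ≤ m + 1`, and the tightness display -/

/-- `D(ADDR_m) ≤ m + 1`. [cite: DeWolf2008, §4.4 p. 10] -/
theorem detQueryComplexity_addrFn_le (m : ℕ) : detQueryComplexity (addrFn m) ≤ m + 1 := by
  have h := detQueryComplexity_le_depth (tree m) (computes_tree m)
  rwa [depth_tree] at h

/-- **`Q_E(ADDR_m) ≤ m + 1`**: the exact quantum query complexity of the address function on `m + 2^m` bits is
at most `m + 1` (the decision tree, simulated exactly: the tree's `Q_E ≤ D`). [cite: AmbainisWolf2012, §1.1 p. 3] -/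
theorem quantumQueryComplexity_zero_addrFn_le (m : ℕ) : quantumQueryComplexity 0 (addrFn m) ≤ m + 1 := by
  have h := quantumQueryComplexity_zero_le_depth (tree m) (computes_tree m)
  rwa [depth_tree] at h

/-- **Tightness display for relevance ceilings.** The address function is a total function on
`n = m + 2^m` bits, ALL of them relevant, with `2^(Q_E − 1) ≤ n`: so no ceiling "number of relevant variables
`≤ g(Q_E)`" valid for every total function can have `g(T) < 2^(T−1)` — the exponential shape of the junta
ceilings (`n ≤ Q_E·4^{Q_E}`) is necessary up to the base. [cite: AmbainisWolf2012, §1.1 p. 3] -/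
theorem two_pow_le_card_of_addrFn (m : ℕ) :
    (∀ i : Fin (m + 2 ^ m), ∃ x, addrFn m (flipBit i x) ≠ addrFn m x) ∧
      2 ^ (quantumQueryComplexity 0 (addrFn m) - 1) ≤ m + 2 ^ m := by
  refine ⟨addrFn_depends_on_all, ?_⟩
  have h := quantumQueryComplexity_zero_addrFn_le m
  calc 2 ^ (quantumQueryComplexity 0 (addrFn m) - 1) ≤ 2 ^ m := Nat.pow_le_pow_right (by norm_num) (by omega)
    _ ≤ m + 2 ^ m := Nat.le_add_left _ _

/-! ### Checks -/

/-- `m = 3`: `11` relevant bits, `Q_E ≤ 4` (the junta ceiling allows up to `4·4^4 = 1024` relevant bits at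
`Q_E = 4`). [cite: AmbainisWolf2012, §1.1 p. 3] -/
example : quantumQueryComplexity 0 (addrFn 3) ≤ 4 := quantumQueryComplexity_zero_addrFn_le 3

/-- `m = 5`: `37` relevant bits, `Q_E ≤ 6`. [cite: AmbainisWolf2012, §1.1 p. 3] -/
example : quantumQueryComplexity 0 (addrFn 5) ≤ 6 := quantumQueryComplexity_zero_addrFn_le 5

/-- `m = 1`: `ADDR_1(x_1 y_0 y_1) = y_{x_1}` is the selector on `3` bits: `D ≤ 2` and `Q_E ≤ 2`.
[cite: DeWolf2008, §4.4 p. 10] -/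
example : detQueryComplexity (addrFn 1) ≤ 2 ∧ quantumQueryComplexity 0 (addrFn 1) ≤ 2 :=
  ⟨detQueryComplexity_addrFn_le 1, quantumQueryComplexity_zero_addrFn_le 1⟩

end Literature.Computability.QuantumComplexity.AddressFunction
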